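import Summits.CriticalPhenomena.PercolationContinuityZ3.Theorems.Transplant.KNCellsBoxProdZ2RLevel
import HarnessLib

/-!
# The CONCENTRIC `X □ ℤ²` cell geometry (design (D), lead ruling V56): regions concentric about the root fibre `w₀`, anchor type `ℕ` (depth,
# rule `a ↦ a + 1`), scheduled fibre radii, STAIRCASE stubs / faces / corridors; the six geometry records of `samePWitnessAt_of_kit₂'`

builds on p205010 (kernel theorem, internal audit signed; external expert review pending) — nothing in this file uses p205010.
Lane `prim-bschramm`, seat `prim-bschramm-p3` (order I1 of V56); helper file (`--supports stmt-CriticalPhenomena-4575 --as helper`).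
Generalises `KNCellsBoxProdZ2R` to the concentric design (HOME/ENTRY-SEED-STAR.md §10, P5-SHARPNESS.md §17.8 c1–c4).
* `stair X w₀ ρ P = {y | y.2 ∈ P, y.1 ∈ B_X(w₀, ρ y.2)}` (row-dependent fibre radius) and its containment lemmas;
* `ConcRadii` — schedule `E b` (probe regions of depth `b`: `Q`, `Btw`, `E^far`, zones), `ρ b ℓ` (corridor sets at planar level `ℓ`), `rM b`
  (target cube); `ConcRadii.WF C` = the ONLY inequalities the records need (`E (b-1) ≤ E b`, `ρ b ℓ ≤ E b`, `ρ b ℓ ≤ E (b-1)` on levels `≤ 5r`,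
  `rM b ≤ E b`) — the growth gaps of (D) enter the kit discharge, not the geometry;
* `cellGeomC X C w₀ Λ : CellGeom (W × Site 2) ℕ` (`anchSet a v = {a, a+1}`), `faceDataC`, `levelDataC`, and **`runGeomC`, `anchGeomC`,
  `sepGeomC`, `sepGeom₂C`, `exitGeomC`, `stepsGeomC`, `levelGeomC`** from `Λ.WF C` alone.
Why staircases: with per-level growing radii a PRODUCT stub violates `LevelGeom.mem_Stub` (`H ∩ {lev ≤ L j} ⊆ H^j`) and
`SepGeom.Stub_subset_Q_union_Btw` (the stub's base row lies in the previous probe's cube); one profile `ρ b` for `H^j`, `F^j`, `H` satisfies both.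

[cite: KozmaNitzan2024, §4 pp. 25–27, 30–31 (Q_v, M_v, E_{v,x}, H^j_{v,x}, F^j_{v,x}) — the ℤ^d model]
-/

noncomputable section

open scoped Classical

namespace Summit.CriticalPhenomena.PercolationContinuityZ3.Theorems

namespace Transplant

namespace BoxProdZ2

open Literature.Probability.Percolation Literature.Probability.LatticeModels SimpleGraph GadgetSystem Contour KNCells
open Literature.Probability.Percolation.KozmaNitzan.Cells (oth oth_ne oth_oth sgOf sgOf_sign stepVec_apply_fst stepVec_apply_oth eq_oth_of_ne)
open Literature.Barriers.CriticalPhenomena (graphBall graphBall_finite mem_graphBall_self graphBall_mono)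

variable {W : Type} (X : SimpleGraph W) [X.LocallyFinite]

/-! ## §1 Staircase sets -/

section Stair

variable [DecidableEq W]

omit [X.LocallyFinite] in
/-- **The staircase set** over a planar set `P` with fibre-radius profile `ρ` about the root fibre `w₀`: the pairs `(w, t)` with `t ∈ P` and
`w ∈ B_X(w₀, ρ t)`. [this work] -/
def stair (w₀ : W) (ρ : Site 2 → ℕ) (P : Finset (Site 2)) : Finset (W × Site 2) :=
  P.biUnion fun t => ballFin X w₀ (ρ t) ×ˢ ({t} : Finset (Site 2))

/-- Membership in a staircase set. [folklore] -/
theorem mem_stair {w₀ : W} {ρ : Site 2 → ℕ} {P : Finset (Site 2)} {y : W × Site 2} :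
    y ∈ stair X w₀ ρ P ↔ y.2 ∈ P ∧ y.1 ∈ ballFin X w₀ (ρ y.2) := by
  constructor
  · intro h
    obtain ⟨t, ht, hy⟩ := Finset.mem_biUnion.1 h
    obtain ⟨h1, h2⟩ := Finset.mem_product.1 hy
    rw [Finset.mem_singleton] at h2
    subst h2
    exact ⟨ht, h1⟩
  · rintro ⟨h2, h1⟩
    exact Finset.mem_biUnion.2 ⟨y.2, h2, Finset.mem_product.2 ⟨h1, Finset.mem_singleton_self _⟩⟩

/-- Staircase sets grow with the planar set and the profile. [folklore] -/
theorem stair_mono {w₀ : W} {ρ ρ' : Site 2 → ℕ} {P P' : Finset (Site 2)} (hP : P ⊆ P') (hρ : ∀ t ∈ P, ρ t ≤ ρ' t) :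
    stair X w₀ ρ P ⊆ stair X w₀ ρ' P' := by
  intro y hy
  rw [mem_stair] at hy ⊢
  exact ⟨hP hy.1, ballFin_mono X w₀ (hρ _ hy.1) hy.2⟩

/-- A staircase set with profile `≤ R` lies in the product `B_X(w₀, R) × P'`, `P ⊆ P'`. [folklore] -/
theorem stair_subset_product {w₀ : W} {ρ : Site 2 → ℕ} {P P' : Finset (Site 2)} {R : ℕ} (hP : P ⊆ P') (hρ : ∀ t ∈ P, ρ t ≤ R) :
    stair X w₀ ρ P ⊆ ballFin X w₀ R ×ˢ P' := by
  intro y hy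
  rw [mem_stair] at hy
  exact Finset.mem_product.2 ⟨ballFin_mono X w₀ (hρ _ hy.1) hy.2, hP hy.1⟩

/-- A staircase set over `P ⊆ P₁ ∪ P₂`, with profile `≤ R₁` on `P₁` and `≤ R₂` on `P₂`, lies in `B(w₀, R₁) × P₁ ∪ B(w₀, R₂) × P₂`. [folklore] -/
theorem stair_subset_union {w₀ : W} {ρ : Site 2 → ℕ} {P P₁ P₂ : Finset (Site 2)} {R₁ R₂ : ℕ} (hP : P ⊆ P₁ ∪ P₂)
    (h₁ : ∀ t ∈ P, t ∈ P₁ → ρ t ≤ R₁) (h₂ : ∀ t ∈ P, t ∈ P₂ → ρ t ≤ R₂) :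
    stair X w₀ ρ P ⊆ ballFin X w₀ R₁ ×ˢ P₁ ∪ ballFin X w₀ R₂ ×ˢ P₂ := by
  intro y hy
  rw [mem_stair] at hy
  rcases Finset.mem_union.1 (hP hy.1) with h | h
  · exact Finset.mem_union_left _ (Finset.mem_product.2 ⟨ballFin_mono X w₀ (h₁ _ hy.1 h) hy.2, h⟩)
  · exact Finset.mem_union_right _ (Finset.mem_product.2 ⟨ballFin_mono X w₀ (h₂ _ hy.1 h) hy.2, h⟩)

end Stair
/-! ## §2 Planar supplement: a transverse neighbour inside a stub -/

/-- Every point of a stub has a TRANSVERSE `ℤ²`-neighbour in the stub (same level). [folklore] -/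
theorem exists_adj_sameLevel_of_mem_Stub (C : PCells) (v : Site 2) (δ : MDir) (j : ℕ) {t : Site 2} (ht : t ∈ C.Stub v δ j) :
    ∃ t' ∈ C.Stub v δ j, (zdGraph 2).Adj t t' ∧ C.lev δ v t' = C.lev δ v t := by
  rw [PCells.Stub, PCells.mem_psBox_iff] at ht
  obtain ⟨hl, h3, h4⟩ := ht
  have hr : (1 : ℤ) ≤ C.r := by exact_mod_cast C.one_le_r
  -- the transverse step `e = (oth δ.1, b)`
  have key : ∀ b : Bool, (t + stepVec (oth δ.1, b)) δ.1 = t δ.1 ∧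
      (t + stepVec (oth δ.1, b)) (oth δ.1) = t (oth δ.1) + sgOf (oth δ.1, b) := by
    intro b
    refine ⟨?_, ?_⟩
    · have h := stepVec_apply_oth (oth δ.1, b)
      simp only [oth_oth] at h
      rw [Pi.add_apply, h, add_zero]
    · have h := stepVec_apply_fst (oth δ.1, b)
      simp only at h
      rw [Pi.add_apply, h]
  have hlev : ∀ b : Bool, C.lev δ v (t + stepVec (oth δ.1, b)) = C.lev δ v t := fun b => by
    simp only [PCells.lev, (key b).1]
  by_cases h : t (oth δ.1) + 1 ≤ C.cen v (oth δ.1) + 2 * C.r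
  · refine ⟨t + stepVec (oth δ.1, true), ?_, (zdGraph_adj_iff_stepVec t _).2 ⟨(oth δ.1, true), rfl⟩, hlev true⟩
    rw [PCells.Stub, PCells.mem_psBox_iff, (key true).1, (key true).2]
    simp only [sgOf, if_true]
    exact ⟨hl, by omega, h⟩
  · refine ⟨t + stepVec (oth δ.1, false), ?_, (zdGraph_adj_iff_stepVec t _).2 ⟨(oth δ.1, false), rfl⟩, hlev false⟩
    rw [PCells.Stub, PCells.mem_psBox_iff, (key false).1, (key false).2]
    simp only [sgOf, Bool.false_eq_true, if_false]
    exact ⟨hl, by omega, by omega⟩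

omit [X.LocallyFinite] in
/-! ## §3 The radius schedule -/

/-- **The fibre-radius schedule of the concentric design**: probe radius `E b` of depth `b` (cubes `Q`, between-boxes, far boxes, zones),
corridor profile `ρ b ℓ` (fibre radius of the stubs / faces / corridor of depth `b` at planar level `ℓ`), target-cube radius `rM b`.
(D): ENTRY-SEED-STAR.md §10; c1–c3 of P5-SHARPNESS §17.8 constrain the schedule further (growth gaps), not here. [this work] -/
structure ConcRadii where
  /-- fibre radius of the probe regions of depth `b`: `Q b`, `Btw b`, `Efar b`, `Zone b` -/
  E : ℕ → ℕ
  /-- fibre radius of the corridor sets of depth `b` (stubs, faces, `H`) at planar level `ℓ` -/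
  ρ : ℕ → ℤ → ℕ
  /-- fibre radius of the target cube `M b` -/
  rM : ℕ → ℕ

/-- **Well-formedness of a schedule** w.r.t. the planar cells `C` — exactly what the six geometry records use: the probe radii do not
decrease with the depth, the corridor profile of depth `b` stays within `E b` and, on the levels `≤ 5r` (the stub's base row, inside the cube
of the PREVIOUS depth), within `E (b-1)`; the target cube within `E b`. [this work] -/
structure ConcRadii.WF (C : PCells) (Λ : ConcRadii) : Prop where
  /-- probe radii do not decrease -/
  mono : ∀ b, Λ.E b ≤ Λ.E (b + 1)
  /-- the corridor profile stays inside the probe radius of its own depth -/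
  ρ_le : ∀ b ℓ, Λ.ρ b ℓ ≤ Λ.E b
  /-- on the base levels the profile stays inside the probe radius of the previous depth -/
  ρ_base : ∀ b ℓ, ℓ ≤ 5 * (C.r : ℤ) → Λ.ρ b ℓ ≤ Λ.E (b - 1)
  /-- the target cube stays inside the probe radius -/
  rM_le : ∀ b, Λ.rM b ≤ Λ.E b

namespace ConcRadii.WF

variable {C : PCells} {Λ : ConcRadii} (hΛ : Λ.WF C)
include hΛ

/-- `E (b - 1) ≤ E b`. [folklore] -/
theorem E_pred_le (b : ℕ) : Λ.E (b - 1) ≤ Λ.E b := by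
  rcases b with _ | b
  · exact le_rfl
  · exact hΛ.mono b

/-- The radius comparisons at an admissible departure anchor `b' ∈ {a, a+1}`: `E (b'-1) ≤ E a ≤ E b' ≤ E (a+1)`. [folklore] -/
theorem E_of_mem {a b' : ℕ} (h : b' ∈ ({a, a + 1} : Finset ℕ)) :
    Λ.E (b' - 1) ≤ Λ.E a ∧ Λ.E a ≤ Λ.E b' ∧ Λ.E b' ≤ Λ.E (a + 1) := by
  rw [Finset.mem_insert, Finset.mem_singleton] at h
  rcases h with rfl | rfl
  · exact ⟨hΛ.E_pred_le _, le_rfl, hΛ.mono _⟩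
  · exact ⟨le_rfl, hΛ.mono _, le_rfl⟩

end ConcRadii.WF

/-! ## §4 The concentric cell geometry -/

section Geom

variable [DecidableEq W]

/-- **The concentric `X □ ℤ²` cell geometry** over the anchor type `ℕ` (depth): KN's planar cells times fibre balls about the root fibre `w₀`
with scheduled radii; staircase stubs; anchor rule `a ↦ a + 1`, admissible anchors `{a, a+1}`; column of `x` = `{y | y.2 = cen x}`.
[cite: KozmaNitzan2024, §4 pp. 25–26 (Q_v, M_v, E_{v,x}, H^j_{v,x})] -/
def cellGeomC (C : PCells) (w₀ : W) (Λ : ConcRadii) : CellGeom (W × Site 2) ℕ where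
  K := C.K
  root := (w₀, 0)
  a₀ := 0
  Q := fun a v => ballFin X w₀ (Λ.E a) ×ˢ C.Q v
  M := fun a v => ballFin X w₀ (Λ.rM a) ×ˢ C.M v
  Cell := fun a v => ballFin X w₀ (Λ.E (a + 1)) ×ˢ C.Cell v
  Btw := fun a v δ => ballFin X w₀ (Λ.E a) ×ˢ C.Btw v δ
  Efar := fun a v δ => ballFin X w₀ (Λ.E a) ×ˢ C.Efar v δ
  Stub := fun a v δ j => stair X w₀ (fun t => Λ.ρ a (C.lev δ v t)) (C.Stub v δ j)
  Zone := fun a v δ => ballFin X w₀ (Λ.E a) ×ˢ C.Zone v δ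
  col := fun x => {y | y.2 = C.cen x}
  anchor := fun a _ _ => a + 1
  anchSet := fun a _ => {a, a + 1}
  anchor_mem := fun a _ _ => Finset.mem_insert_of_mem (Finset.mem_singleton_self _)
  stub_mono := fun _ v δ _ _ h => stair_mono X (C.Stub_mono v δ h) fun _ _ => le_rfl
  hK := by have := C.hK; omega

/-- **Faces and corridors** of the concentric geometry: staircases with the same profile as the stubs. [cite: KozmaNitzan2024, §4 p. 26 (H_{v,x}), p. 30 (F^j_{v,x})] -/
def faceDataC (C : PCells) (w₀ : W) (Λ : ConcRadii) : FaceData (W × Site 2) ℕ where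
  Face := fun a v δ j => stair X w₀ (fun t => Λ.ρ a (C.lev δ v t)) (C.Face v δ j)
  Hfull := fun a v δ => stair X w₀ (fun t => Λ.ρ a (C.lev δ v t)) (C.Hfull v δ)

omit [DecidableEq W] in
/-- **Level data** (fibre-blind planar level along the macro-direction, `L j = 5r + 10sj`, `ℓQ = 5r`). [cite: KozmaNitzan2024, §4 p. 30] -/
def levelDataC (C : PCells) : LevelData (W × Site 2) ℕ where
  lev := fun _ v δ y => C.lev δ v y.2
  L := fun j => 5 * C.r + 10 * C.s * j
  ℓQ := 5 * C.r

variable (C : PCells) (w₀ : W) {Λ : ConcRadii} (hΛ : Λ.WF C)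
/-! ## §5 The six records -/
/-- `RunGeom`: planar steps inside the boxes (transverse steps inside the staircase stubs). [folklore] -/
theorem runGeomC : RunGeom (X □ zdGraph 2) (cellGeomC X C w₀ Λ) where
  adjQ _ v _ hy := exists_adj_product X (fun _ ht => C.exists_adj_of_mem_Q v ht) hy
  adjBtw _ v δ _ hy := exists_adj_product X (fun _ ht => C.exists_adj_of_mem_Btw v δ ht) hy
  adjStub a v δ j _ y hy := by
    change y ∈ stair X w₀ (fun t => Λ.ρ a (C.lev δ v t)) (C.Stub v δ j) at hy
    rw [mem_stair] at hy
    obtain ⟨t', ht', hadj, hlev⟩ := exists_adj_sameLevel_of_mem_Stub C v δ j hy.1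
    refine ⟨(y.1, t'), ?_, (boxProd_adj).2 (Or.inr ⟨hadj, rfl⟩)⟩
    change (y.1, t') ∈ stair X w₀ (fun t => Λ.ρ a (C.lev δ v t)) (C.Stub v δ j)
    rw [mem_stair]
    refine ⟨ht', ?_⟩
    change y.1 ∈ ballFin X w₀ (Λ.ρ a (C.lev δ v t'))
    rw [hlev]; exact hy.2

/-- `AnchGeom`: `a ∈ {a, a+1}`, and the admissible anchors do not depend on the macro-vertex. [folklore] -/
theorem anchGeomC : AnchGeom (cellGeomC X C w₀ Λ) where
  refl a _ := Finset.mem_insert_self a {a + 1}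
  const _ _ _ := rfl

include hΛ

/-- **`SepGeom`** for the concentric geometry (containments from the schedule's order, disjointness / separation planar). [cite: KozmaNitzan2024, §4 pp. 26–29] -/
theorem sepGeomC : SepGeom (X □ zdGraph 2) (cellGeomC X C w₀ Λ) where
  anch_refl a _ := Finset.mem_insert_self a {a + 1}
  root_mem := by
    change (w₀, (0 : Site 2)) ∈ ballFin X w₀ (Λ.E 0) ×ˢ C.Q 0
    exact Finset.mem_product.2 ⟨(mem_ballFin X).2 (mem_graphBall_self X w₀ _), C.zero_mem_Q_zero⟩
  Q_subset_Cell a v := Finset.product_subset_product (ballFin_mono X w₀ (hΛ.mono a)) (C.Q_subset_Cell v)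
  Btw_subset_Cells a a' v δ ha' := by
    obtain ⟨-, -, h3⟩ := hΛ.E_of_mem ha'
    change ballFin X w₀ (Λ.E a') ×ˢ C.Btw v δ ⊆ ballFin X w₀ (Λ.E (a + 1)) ×ˢ C.Cell v ∪ ballFin X w₀ (Λ.E (a' + 1)) ×ˢ C.Cell (v + stepVec δ)
    exact product_subset_union (ballFin_mono X w₀ h3) (ballFin_mono X w₀ (hΛ.mono a')) (C.Btw_subset_Cells v δ)
  Stub_subset_Q_union_Btw a a' v δ j ha' hj := by
    obtain ⟨h1, -, -⟩ := hΛ.E_of_mem ha'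
    change stair X w₀ (fun t => Λ.ρ a' (C.lev δ v t)) (C.Stub v δ j) ⊆ ballFin X w₀ (Λ.E a) ×ˢ C.Q v ∪ ballFin X w₀ (Λ.E a') ×ˢ C.Btw v δ
    refine stair_subset_union X (C.Stub_subset_Q_union_Btw v δ (by change j + 1 ≤ C.K at hj; omega)) ?_ ?_
    · intro t _ htQ
      exact (hΛ.ρ_base a' _ (C.lev_le_of_mem_Q htQ)).trans h1
    · intro t _ _; exact hΛ.ρ_le a' _
  Stub_subset_Cell_union_Zone a a' v δ j ha' hj := by
    obtain ⟨-, -, h3⟩ := hΛ.E_of_mem ha'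
    change stair X w₀ (fun t => Λ.ρ a' (C.lev δ v t)) (C.Stub v δ j) ⊆
      ballFin X w₀ (Λ.E (a + 1)) ×ˢ C.Cell v ∪ ballFin X w₀ (Λ.E a') ×ˢ C.Zone v δ
    refine stair_subset_union X (C.Stub_subset_Cell_union_Zone v δ (by change j + 1 ≤ C.K at hj; omega)) ?_ ?_
    · intro t _ _; exact (hΛ.ρ_le a' _).trans h3
    · intro t _ _; exact hΛ.ρ_le a' _
  Efar_subset_Btw_union_Q a v δ := by
    change ballFin X w₀ (Λ.E a) ×ˢ C.Efar v δ ⊆ ballFin X w₀ (Λ.E a) ×ˢ C.Btw v δ ∪ ballFin X w₀ (Λ.E a) ×ˢ C.Q (v + stepVec δ)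
    exact product_subset_union le_rfl le_rfl (C.Efar_subset_Btw_union_Q v δ)
  Ewv_disjoint_Efar a a' w δw du hdu := by
    change Disjoint (ballFin X w₀ (Λ.E a) ×ˢ C.Btw w δw ∪ ballFin X w₀ (Λ.E a) ×ˢ C.Q (w + stepVec δw))
      (ballFin X w₀ (Λ.E a') ×ˢ C.Efar (w + stepVec δw) du)
    have h := C.Ewv_disjoint_Efar w hdu
    rw [PCells.Ewv, Finset.disjoint_union_left] at h
    rw [Finset.disjoint_union_left]
    exact ⟨disjoint_product_of_right h.1, disjoint_product_of_right h.2⟩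
  Q_disjoint_Q a a' u x hux := disjoint_product_of_right (C.Q_disjoint_Q hux)
  Q_disjoint_Btw a a' x v δ := disjoint_product_of_right (C.Q_disjoint_Btw x v δ)
  Btw_disjoint_Btw a a' v δ v' δ' h1 h2 := disjoint_product_of_right (C.Btw_disjoint_Btw h1 h2)
  Q_disjoint_Efar a a' v δ := disjoint_product_of_right (C.Q_disjoint_Efar v δ)
  Btw_disjoint_Efar a a' v δ δ' h := disjoint_product_of_right (C.Btw_disjoint_Efar v h)
  col_Q a x := ⟨(w₀, C.cen x), Finset.mem_product.2 ⟨(mem_ballFin X).2 (mem_graphBall_self X w₀ _), C.cen_mem_Q x⟩, rfl⟩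
  col_Cell a u x hux y hy hcol := by
    change y.2 = C.cen x at hcol
    exact C.cen_not_mem_Cell hux (hcol ▸ (Finset.mem_product.1 hy).2)
  col_Zone a u δ x y hy hcol := by
    change y.2 = C.cen x at hcol
    exact C.cen_not_mem_Zone u δ x (hcol ▸ (Finset.mem_product.1 hy).2)

/-- **`SepGeom₂`** (cross-anchor containments `Q_a ⊆ Cell_{a'}`, `Btw_a ⊆ Cell_a ∪ Cell_{a'}` for `a' ∈ {a, a+1}`). [cite: KozmaNitzan2024, §4 pp. 25–26] -/
theorem sepGeom₂C : SepGeom₂ (X □ zdGraph 2) (cellGeomC X C w₀ Λ) where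
  toSepGeom := sepGeomC X C w₀ hΛ
  Q_subset_Cell₂ a a' x ha' := by
    obtain ⟨-, h2, -⟩ := hΛ.E_of_mem ha'
    change ballFin X w₀ (Λ.E a) ×ˢ C.Q x ⊆ ballFin X w₀ (Λ.E (a' + 1)) ×ˢ C.Cell x
    exact Finset.product_subset_product (ballFin_mono X w₀ (h2.trans (hΛ.mono a'))) (C.Q_subset_Cell x)
  Btw_subset_Cells₂ a a' v δ ha' := by
    obtain ⟨-, h2, -⟩ := hΛ.E_of_mem ha'
    change ballFin X w₀ (Λ.E a) ×ˢ C.Btw v δ ⊆ ballFin X w₀ (Λ.E (a + 1)) ×ˢ C.Cell v ∪ ballFin X w₀ (Λ.E (a' + 1)) ×ˢ C.Cell (v + stepVec δ)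
    exact product_subset_union (ballFin_mono X w₀ (hΛ.mono a)) (ballFin_mono X w₀ (h2.trans (hΛ.mono a'))) (C.Btw_subset_Cells v δ)

/-- **`ExitGeom`** for the concentric geometry. [cite: KozmaNitzan2024, §4 pp. 26–27] -/
theorem exitGeomC : ExitGeom (X □ zdGraph 2) (cellGeomC X C w₀ Λ) where
  M_subset_Q a v := Finset.product_subset_product (ballFin_mono X w₀ (hΛ.rM_le a)) (C.M_subset_Q v)
  Cell_disjoint_Q a a' u x hux := disjoint_product_of_right (C.Cell_disjoint_Q hux)
  Zone_disjoint_Q a a' u δ x := disjoint_product_of_right (C.Zone_disjoint_Q u δ x)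
  locFin y := by
    set B : Site 2 := fun i => |y.2 i| + 35 * C.r + 1 with hB
    refine (Finset.Icc (-B) B).finite_toSet.subset ?_
    rintro v ⟨a, w, δ, rfl, b, hb, hadj⟩
    change b ∈ ballFin X w₀ (Λ.E a) ×ˢ C.Btw w δ ∪ ballFin X w₀ (Λ.E a) ×ˢ C.Q (w + stepVec δ) at hb
    have hb2 : b.2 ∈ C.Ewv w δ := by
      rw [PCells.Ewv, Finset.mem_union]
      rcases Finset.mem_union.1 hb with h | h
      · exact Or.inl (Finset.mem_product.1 h).2
      · exact Or.inr (Finset.mem_product.1 h).2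
    have hnear : ∀ i, |b.2 i - y.2 i| ≤ 1 := by
      intro i
      rcases (boxProd_adj).1 hadj with ⟨-, h2⟩ | ⟨h2, -⟩
      · rw [h2, sub_self, abs_zero]; exact zero_le_one
      · exact abs_sub_comm (b.2 i) (y.2 i) ▸ DCT16.abs_sub_le_one_of_adj h2 i
    rw [Finset.coe_Icc, Set.mem_Icc]
    have key : ∀ i, |(w + stepVec δ) i| ≤ B i := by
      intro i
      have h1 := sub_cen_le_of_mem_Ewv C hb2 i
      have h2 := hnear i
      rw [abs_le] at h1 h2 ⊢
      simp only [PCells.cen_apply] at h1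
      simp only [hB]
      have hy := abs_nonneg (y.2 i)
      have hy' := le_abs_self (y.2 i)
      have hy'' := neg_abs_le (y.2 i)
      have hr : (1 : ℤ) ≤ C.r := by exact_mod_cast C.one_le_r
      constructor <;> nlinarith
    exact ⟨fun i => (abs_le.1 (key i)).1, fun i => (abs_le.1 (key i)).2⟩

/-- **`StepsGeom`** for the concentric geometry (faces ⊆ stubs ⊆ corridor: same profile; corridor ⊆ `Q_{arr} ∪ E^far`: base levels within
`E (b-1)`). [cite: KozmaNitzan2024, §4 pp. 26, 30] -/
theorem stepsGeomC : StepsGeom (cellGeomC X C w₀ Λ) (faceDataC X C w₀ Λ) where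
  Face_subset_Stub a v δ j := stair_mono X (C.Face_subset_Stub v δ j) fun _ _ => le_rfl
  Stub_subset_Hfull a v δ j hj := stair_mono X (C.Stub_subset_Hfull v δ (by change j ≤ C.K at hj; exact hj)) fun _ _ => le_rfl
  Hfull_subset a a' v δ ha' := by
    obtain ⟨h1, -, -⟩ := hΛ.E_of_mem ha'
    change stair X w₀ (fun t => Λ.ρ a' (C.lev δ v t)) (C.Hfull v δ) ⊆ ballFin X w₀ (Λ.E a) ×ˢ C.Q v ∪ ballFin X w₀ (Λ.E a') ×ˢ C.Efar v δ
    refine stair_subset_union X (C.Hfull_subset_Q_union_Efar v δ) ?_ ?_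
    · intro t _ htQ
      exact (hΛ.ρ_base a' _ (C.lev_le_of_mem_Q htQ)).trans h1
    · intro t _ _; exact hΛ.ρ_le a' _
  M_tgt_subset_Efar a v δ := Finset.product_subset_product (ballFin_mono X w₀ (hΛ.rM_le a)) (C.M_add_stepVec_subset_Efar v δ)

/-- **`LevelGeom`** for the concentric geometry (the staircase truncated at `L j` is the stub `H^j`; everything else planar). [cite: KozmaNitzan2024, §4 p. 31 (Step IV)] -/
theorem levelGeomC : LevelGeom (X □ zdGraph 2) (cellGeomC X C w₀ Λ) (faceDataC X C w₀ Λ) (levelDataC (W := W) C) where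
  adj_le a' v δ y z h := by
    change C.lev δ v z.2 ≤ C.lev δ v y.2 + 1
    rcases (boxProd_adj).1 h with ⟨-, h2⟩ | ⟨h2, -⟩
    · rw [h2]; omega
    · rcases C.lev_adj δ v h2 with h' | h' | h' <;> omega
  lev_Q a a' v δ _ y hy := C.lev_le_of_mem_Q (Finset.mem_product.1 hy).2
  lev_Hfull a' v δ y hy hn := by
    change y ∈ stair X w₀ (fun t => Λ.ρ a' (C.lev δ v t)) (C.Hfull v δ) at hy
    rw [mem_stair] at hy
    refine lev_le_of_mem_Hfull_not_Efar' C hy.1 fun h' => hn ?_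
    change y ∈ ballFin X w₀ (Λ.E a') ×ˢ C.Efar v δ
    exact Finset.mem_product.2 ⟨ballFin_mono X w₀ (hΛ.ρ_le a' _) hy.2, h'⟩
  ℓQ_lt j hj := by
    change 5 * (C.r : ℤ) < 5 * C.r + 10 * C.s * j
    have hs1 : (1 : ℤ) ≤ C.s := by exact_mod_cast C.hs
    have : (1 : ℤ) ≤ j := by exact_mod_cast hj
    nlinarith
  mem_Stub a' v δ j _ _ y hy hl := by
    change y ∈ stair X w₀ (fun t => Λ.ρ a' (C.lev δ v t)) (C.Hfull v δ) at hy
    change y ∈ stair X w₀ (fun t => Λ.ρ a' (C.lev δ v t)) (C.Stub v δ j)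
    rw [mem_stair] at hy ⊢
    exact ⟨C.mem_Stub_of_mem_Hfull hy.1 hl, hy.2⟩
  mem_Face a' v δ j _ _ y hy hl := by
    change y ∈ stair X w₀ (fun t => Λ.ρ a' (C.lev δ v t)) (C.Hfull v δ) at hy
    change y ∈ stair X w₀ (fun t => Λ.ρ a' (C.lev δ v t)) (C.Face v δ j)
    rw [mem_stair] at hy ⊢
    exact ⟨C.mem_Face_of_mem_Hfull hy.1 hl, hy.2⟩
  Face_far a' v δ j hjK t ht := by
    change t ∈ stair X w₀ (fun t => Λ.ρ a' (C.lev δ v t)) (C.Face v δ (j + 1)) at ht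
    rw [mem_stair] at ht
    obtain ⟨hE, hl⟩ := Face_far' C (by change j + 1 ≤ C.K at hjK; exact hjK) ht.1
    refine ⟨?_, hl⟩
    change t ∈ ballFin X w₀ (Λ.E a') ×ˢ C.Efar v δ
    exact Finset.mem_product.2 ⟨ballFin_mono X w₀ (hΛ.ρ_le a' _) ht.2, hE⟩
  M_far a' v δ t ht := by
    obtain ⟨h1, h2⟩ := Finset.mem_product.1 ht
    have hl := C.lev_ge_of_mem_M_add (δ := δ) h2
    have hr : (1 : ℤ) ≤ C.r := by exact_mod_cast C.one_le_r
    have hrK : (C.r : ℤ) = C.K * C.s := by simp [PCells.r]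
    refine ⟨Finset.mem_product.2 ⟨ballFin_mono X w₀ (hΛ.rM_le a') h1, C.M_add_stepVec_subset_Efar v δ h2⟩, ?_⟩
    change 5 * (C.r : ℤ) + 10 * C.s * (C.K : ℕ) + 1 ≤ C.lev δ v t.2
    nlinarith
  Btw_sep_Efar a a' w δw du hdu := by
    change KNCells.Sep (X □ zdGraph 2) (ballFin X w₀ (Λ.E a) ×ˢ C.Btw w δw) (ballFin X w₀ (Λ.E a') ×ˢ C.Efar (w + stepVec δw) du)
    rw [← C.Btw_rev' w δw]
    exact sep_prodR X (C.Btw_sep_Efar (w + stepVec δw) (Ne.symm hdu))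
  Cell_sep_Efar b a' u v δ huv hux := sep_prodR X (C.Cell_sep_Efar huv hux)
  Zone_sep_Efar b a' u δ' v δ huv hux := sep_prodR X (C.Zone_sep_Efar huv hux δ')

end Geom

end BoxProdZ2

end Transplant

end Summit.CriticalPhenomena.PercolationContinuityZ3.Theorems

end
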